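import Literature.AlgebraicTopology.SingularHomology.FiltrationCapEndo
import Literature.AlgebraicTopology.SingularHomology.UniversalCoefficientsField
import Literature.AlgebraicTopology.SingularHomology.CupProductProofs
import Mathlib.LinearAlgebra.Dual.Lemmas
import HarnessLib

/-!
# Cup-generation of `H⁴` from hard Lefschetz on the `E¹`-term of a three-stage filtration
# (the Leray–Künneth step of Arapura 2022, Cor. 1.5, in homological form)

Topic `Literature/AlgebraicTopology/SingularHomology`, sibling of `FiltrationExactCouple.lean`
(the homology exact couple of an increasing filtration `X₀ ⊆ X₁ ⊆ ⋯`, Spanier 1981, Ch. 9 §1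
Ex. 5–6), `FiltrationCapEndo.lean` (the cap product with `η ∈ H²(X; K)` is a Lefschetz
endomorphism `Filtration.capEndo` of that couple, Voisin II Lemma 4.13) and
`Literature/Algebra/Homology/ExactCoupleLefschetz.lean` (`LefschetzEndo`, `EHardLefschetz`,
Deligne's degeneration). It isolates the TOPOLOGICAL content of the last paragraph of the proof
of D. Arapura, *Hodge cycles and the Leray filtration*, Pacific J. Math. 319 (2022), Cor. 1.5
(p. 5): for a smooth projective family of `p_g = 0` surfaces `V → U` over an affine surface with
relative divisors `𝒵_i` whose classes span `R²f_*ℚ`, "`H²(U, R²f_*ℚ) ≅ ⊕_i H²(U, ℚ) ∪ [𝒵_i]`",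
which together with hard Lefschetz `∪h : R¹f_*ℚ ≅ R³f_*ℚ` (proof of Thm. 1.2, first reflection)
and `R⁴f_*ℚ = ℚ h²` says, on the (degenerate, by Deligne) Leray spectral sequence, that
**`H⁴(V) = h ∪ H²(V) + Σ_i H²(V) ∪ [𝒵_i]`**. We prove this generation statement for a space `X`
filtered in three stages `X₀ ⊆ X₁ ⊆ X₂ = X` (the skeletal filtration `p⁻¹(Cˢ)` of a surface bundle
over a `2`-complex `C`), from hypotheses placed on the `E¹`-term exactly in the form the tree's
Deligne-degeneration programme produces them (`EHardLefschetz 2` for `h ⌢`, and joint detection of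
`E¹_{2,4} = H₄(X₂, X₁)` by the `[𝒵_i] ⌢`), WITHOUT using degeneration: a direct three-stage descent.

* `HomologyExactCouple.LefschetzEndo.eq_zero_of_LA_eq_zero_of_detect` — **the algebraic core** on
  an abstract homology exact couple with a Lefschetz endomorphism `L` and further endomorphisms
  `Z_i`: if `L : E_{2,5} ↠ E_{2,3}`, `L : E_{1,4} ↪ E_{1,2}`, `L² : E_{1,5} ≅ E_{1,1}`,
  `L² : E_{0,4} ≅ E_{0,0}` and the `Z_i` jointly detect `E_{2,4}`, then a class of `A_{2,4} = H₄(X₂)`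
  killed by `L` and all `Z_i` is zero (descent `X₂ → X₁ → X₀` through the exact sequences of the
  pairs; the last step uses the "retraction" `L⁻² ∘ L`, which commutes with `δ` formally);
  `…_of_eHardLefschetz` — the four hypotheses on `L` are instances of `EHardLefschetz 2`.
* `Filtration.eq_zero_of_capProduct_eq_zero_of_eHardLefschetz` (`…_of_eq_univ`) — the same for
  the couple of a filtered space and `L = η ⌢`, `Z_i = ζ_i ⌢` (`Filtration.capEndo`): joint
  CAP-DETECTION of `H₄(X; K)` by `η` and the `ζ_i`.
* `eq_zero_of_forall_capProduct_eq_zero_of_map` — cap-detection transfers along a map onto in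
  degree `n` and into below (projection formula), e.g. homeomorphisms, weak equivalences.
* `iSup_range_cupProduct_eq_top_of_forall_capProduct_eq_zero`,
  `exists_eq_sum_cupProduct_of_forall_capProduct_eq_zero` — **duality**: over a field, with
  `H_n(X; K)` finite-dimensional, joint cap-detection of `H_n` by classes `g_j` IS cup-generation
  `Hⁿ = Σ_j g_j ⌣ H^{n-d_j}` (universal coefficients `Hⁿ ≅ Hom(H_n, K)`, the adjunction
  `⟨a ⌣ b, x⟩ = ⟨b, a ⌢ x⟩`, and bi-annihilators in a finite-dimensional dual space).
* `Filtration.range_cupProduct_sup_iSup_eq_top_of_eHardLefschetz` — the assembled statement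
  **`H⁴(X; K) = η ⌣ H² + Σ_i ζ_i ⌣ H²`** for `X₂ = X`, `H₄(X; K)` finite-dimensional;
  `cupProduct_comm_two_two` — in these degrees the order of the factors is immaterial.

Everything is proved; no definition of a notion and no named fact is introduced (D-0026). Brick
of the proof of `Literature.AlgebraicGeometry.HodgeTheory.Arapura2022_thm_1_2_smoothPart_pgZeroSurfaceFibration`
(hypothesis `hI`/`hgen` of `…_of_map_mem_span_cupProduct` in
`ArapuraSurfaceFibredFourfoldsSplitProofs.lean`), to be fed by the cellular identification
`E¹_{s,q} ≅ ⊕_{s-cells} H_{q-s}(F)` compatible with cap products, fibrewise hard Lefschetz and the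
Milnor/Mittag-Leffler passage to an exhaustion (`CochainExhaustionMilnor`, `TowerLim1FiniteDimensional`).

## References

* D. Arapura, *Hodge cycles and the Leray filtration*, Pacific J. Math. 319 (2022) 233–258 =
  arXiv:2103.05038, proof of Thm. 1.2 (p. 4) and proof of Cor. 1.5 (p. 5). [Arapura2022]
* C. Voisin, *Hodge Theory and Complex Algebraic Geometry II*, CUP (2003), Lemma 4.13, Thm. 4.15.
  [VoisinHodgeII2003]
* A. Hatcher, *Algebraic Topology*, CUP (2002), §3.1 Thm. 3.2 and p. 198; §3.3 pp. 239–241;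
  Thm. 3.11. [HatcherAT2002]
* E. H. Spanier, *Algebraic Topology*, Springer (1981), Ch. 9, Sec. 1, Ex. 5–6. [Spanier1981]
-/

open Function

universe u v

/-! ### The algebraic core: a three-stage descent in an exact couple with a Lefschetz endomorphism -/

namespace Literature.Algebra.Homology.HomologyExactCouple

variable {K : Type u} [DivisionRing K] (C : HomologyExactCouple.{u, v} K)

/-- `j 0 : A 0 q → E 0 q` is bijective (`A₋₁ = 0`). [cite: Spanier1981, Ch. 9 Sec. 1 Ex. 6] -/
theorem j_zero_bijective (q : ℕ) : Bijective (C.j 0 q) :=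
  ⟨LinearMap.ker_eq_bot.1 (C.ker_j_zero q), LinearMap.range_eq_top.1 (C.range_j_zero q)⟩

namespace LefschetzEndo

variable {C} (L : C.LefschetzEndo)

/-- **Three-stage Lefschetz descent (the algebraic core).** Let `L` be a Lefschetz endomorphism
(degree `(0,-2)`) of a homology exact couple and `Z i` further such endomorphisms. Assume, in the
window of a surface bundle over a `2`-complex (`E¹_{s,q} = ⊕_{s-cells} H_{q-s}(F)`, `dim_ℝ F = 4`):
`L : E_{2,5} → E_{2,3}` onto and `L : E_{1,4} → E_{1,2}` into (hard Lefschetz `H₃(F) ≅ H₁(F)`),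
`L² : E_{1,5} → E_{1,1}` and `L² : E_{0,4} → E_{0,0}` bijective (`H₄(F) ≅ H₀(F)`), and that the
`Z i` jointly detect `E_{2,4}` (`= ⊕ H₂(F)`: the classes span `H²` of the fibres). Then a class
`a ∈ A_{2,4} = H₄(X₂)` killed by `L` and by every `Z i` vanishes. Proof: `j a = 0` by detection, so
`a = ι a₁`; correct `a₁` by `δ` of an `L`-preimage so that `L a₁ = 0`; then `j a₁ = 0` by
injectivity, `a₁ = ι a₀`; finally `L a₀ = δ v` forces `a₀ = δ(L⁻²L v')` by the bijectivity of `L²`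
on `E_{1,•}` and `A_{0,•}` (all squares commute because `L` is a couple endomorphism). This is the
homological dual of "`H⁴ = h ∪ H² + Σ_i H² ∪ [𝒵_i]`" read off the degenerate Leray spectral
sequence in the proof of Arapura 2022, Cor. 1.5 (`H²(U, R²f_*ℚ) ≅ ⊕_i H²(U, ℚ) ∪ [𝒵_i]`, hard
Lefschetz `R¹ ≅ R³` as in the proof of Thm. 1.2), with Deligne's observation that `L` is a
morphism of the couple (Voisin II, Lemma 4.13).
[cite: Arapura2022, proof of Cor. 1.5 (p. 5) and proof of Thm. 1.2 (first reflection)]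
[cite: VoisinHodgeII2003, Lemma 4.13 and Thm. 4.15 (proof)] -/
theorem eq_zero_of_LA_eq_zero_of_detect {ι : Type*} (Z : ι → C.LefschetzEndo)
    (h1 : Surjective (L.LE 2 3)) (h2 : Injective (L.LE 1 2))
    (h3 : Bijective (L.LE 1 1 ∘ L.LE 1 3)) (h4 : Bijective (L.LE 0 0 ∘ L.LE 0 2))
    (hZ : ∀ e : C.E 2 4, (∀ i, (Z i).LE 2 2 e = 0) → e = 0)
    {a : C.A 2 4} (hLa : L.LA 2 2 a = 0) (hZa : ∀ i, (Z i).LA 2 2 a = 0) : a = 0 := by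
  -- Step A: `j a = 0`, so `a = ι a₁`
  have hja : C.j 2 4 a = 0 := hZ _ fun i => by rw [(Z i).comm_j 2 2 a, hZa i, map_zero]
  obtain ⟨a₁, rfl⟩ : a ∈ LinearMap.range (C.ι 4 1 (1 + 1) (Nat.le_succ 1)) := by
    rw [C.range_ι 1 4]
    exact hja
  -- Step B: `L a₁ ∈ ker ι = range δ`; write `L a₁ = δ (L w')` and replace `a₁` by `a₁ - δ w'`
  obtain ⟨w, hw⟩ : L.LA 1 2 a₁ ∈ LinearMap.range (C.δ 1 2) := by
    rw [C.range_δ 1 2, LinearMap.mem_ker, ← L.comm_ι 2 1 (1 + 1) (Nat.le_succ 1) a₁]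
    exact hLa
  obtain ⟨w', rfl⟩ := h1 w
  set a₁' : C.A 1 4 := a₁ - C.δ 1 4 w' with ha₁'
  have hL1 : L.LA 1 2 a₁' = 0 := by
    rw [ha₁', map_sub, sub_eq_zero, ← hw]
    exact (L.comm_δ 1 2 w').symm
  have hι1 : C.ι 4 1 (1 + 1) (Nat.le_succ 1) a₁' = C.ι 4 1 (1 + 1) (Nat.le_succ 1) a₁ := by
    rw [ha₁', map_sub, sub_eq_self, ← LinearMap.mem_ker, ← C.range_δ 1 4]
    exact LinearMap.mem_range_self _ _
  rw [← hι1]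
  -- Step C: `j a₁' = 0` by the injectivity of `L` on `E_{1,4}`, so `a₁' = ι a₀`
  have hja₁ : C.j 1 4 a₁' = 0 := h2 (by rw [L.comm_j 1 2 a₁', hL1, map_zero, map_zero])
  obtain ⟨a₀, ha₀⟩ : a₁' ∈ LinearMap.range (C.ι 4 0 (0 + 1) (Nat.le_succ 0)) := by
    rw [C.range_ι 0 4]
    exact hja₁
  -- Step D: `L a₀ = δ v`; the bijectivity of `L²` on `A_{0,•}` and `E_{1,•}` gives `a₀ ∈ range δ`
  obtain ⟨v, hv⟩ : L.LA 0 2 a₀ ∈ LinearMap.range (C.δ 0 2) := by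
    rw [C.range_δ 0 2, LinearMap.mem_ker, ← L.comm_ι 2 0 (0 + 1) (Nat.le_succ 0) a₀, ha₀]
    exact hL1
  -- `L²` on `A_{0,•}` is bijective (conjugate to `L²` on `E_{0,•}` by the bijective `j 0`)
  have h4A : Bijective (L.LA 0 0 ∘ L.LA 0 2) := by
    have hconj : C.j 0 0 ∘ (L.LA 0 0 ∘ L.LA 0 2) = (L.LE 0 0 ∘ L.LE 0 2) ∘ C.j 0 4 := by
      funext x
      simp only [comp_apply, ← L.comm_j]
    have := (h4.comp (C.j_zero_bijective 4))
    rw [← hconj] at this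
    exact (Bijective.of_comp_iff' (C.j_zero_bijective 0) _).1 this
  -- `δ ∘ L² = L² ∘ δ` from `E_{1,5}`
  obtain ⟨u, hu⟩ := h3.2 (L.LE 1 1 v)
  have hδu : C.δ 0 4 u = a₀ := by
    refine h4A.1 ?_
    change L.LA 0 0 (L.LA 0 2 (C.δ 0 4 u)) = L.LA 0 0 (L.LA 0 2 a₀)
    rw [L.comm_δ 0 2 u, L.comm_δ 0 0, ← hv, L.comm_δ 0 0 v]
    exact congrArg (C.δ 0 0) hu
  rw [← ha₀, ← hδu]
  have : C.δ 0 4 u ∈ LinearMap.ker (C.ι 4 0 (0 + 1) (Nat.le_succ 0)) := by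
    rw [← C.range_δ 0 4]
    exact LinearMap.mem_range_self _ _
  rw [LinearMap.mem_ker] at this
  rw [this, map_zero]

end LefschetzEndo

end Literature.Algebra.Homology.HomologyExactCouple

namespace Literature.Algebra.Homology.HomologyExactCouple.LefschetzEndo

variable {K : Type u} [DivisionRing K] {C : HomologyExactCouple.{u, v} K} (L : C.LefschetzEndo)

/-- `L¹ = L` on `E_{s,•}` (unfolding `iterDown`). [folklore] -/
theorem iterDown_one_apply (s m : ℕ) (x : C.E s (m + 2)) :
    iterDown (V := fun q => C.E s q) (L.LE s) 1 m x = L.LE s m x := rfl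

/-- `L²  = L ∘ L` on `E_{s,•}` (unfolding `iterDown`). [folklore] -/
theorem iterDown_two_apply (s m : ℕ) (x : C.E s (m + 2 + 2)) :
    iterDown (V := fun q => C.E s q) (L.LE s) 2 m x = L.LE s m (L.LE s (m + 2) x) := rfl

/-- **Three-stage Lefschetz descent from hard Lefschetz on `E¹`.** The four Lefschetz hypotheses
of `eq_zero_of_LA_eq_zero_of_detect` are instances of `EHardLefschetz 2` (hard Lefschetz on
`E¹_{s,•}` centred at fibre degree `2`: `Lⁱ : E_{s,s+2+i} ≅ E_{s,s+2-i}`, `i ≤ 2` — the shape of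
`E¹_{s,•} = ⊕_{s-cells} H_{•-s}(F)` for a bundle with fibre a compact Kähler surface and `L` the
cap product with a class restricting to Kähler classes). Hence: if moreover the `Z i` jointly
detect `E_{2,4}`, a class of `A_{2,4} = H₄(X₂)` killed by `L` and all `Z i` is zero.
[cite: Arapura2022, proof of Cor. 1.5 (p. 5) and proof of Thm. 1.2 (first reflection)]
[cite: VoisinHodgeII2003, Lemma 4.13 and Thm. 4.15 (proof)] -/
theorem eq_zero_of_LA_eq_zero_of_eHardLefschetz {ι : Type*} (Z : ι → C.LefschetzEndo)
    (hL : L.EHardLefschetz 2)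
    (hZ : ∀ e : C.E 2 4, (∀ i, (Z i).LE 2 2 e = 0) → e = 0)
    {a : C.A 2 4} (hLa : L.LA 2 2 a = 0) (hZa : ∀ i, (Z i).LA 2 2 a = 0) : a = 0 := by
  refine L.eq_zero_of_LA_eq_zero_of_detect Z ?_ ?_ ?_ ?_ hZ hLa hZa
  · intro y
    obtain ⟨x, hx⟩ := (hL 2 3 1 rfl (by norm_num)).2 y
    exact ⟨x, by rw [← hx, iterDown_one_apply]⟩
  · intro x x' h
    refine (hL 1 2 1 rfl (by norm_num)).1 ?_
    rw [iterDown_one_apply, iterDown_one_apply]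
    exact h
  · have h3 := hL 1 1 2 rfl le_rfl
    have hfun : (iterDown (V := fun q => C.E 1 q) (L.LE 1) 2 1 : C.E 1 5 → C.E 1 1) =
        L.LE 1 1 ∘ L.LE 1 3 := funext fun x => L.iterDown_two_apply 1 1 x
    rw [hfun] at h3
    exact h3
  · have h4 := hL 0 0 2 rfl le_rfl
    have hfun : (iterDown (V := fun q => C.E 0 q) (L.LE 0) 2 0 : C.E 0 4 → C.E 0 0) =
        L.LE 0 0 ∘ L.LE 0 2 := funext fun x => L.iterDown_two_apply 0 0 x
    rw [hfun] at h4
    exact h4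

end Literature.Algebra.Homology.HomologyExactCouple.LefschetzEndo

/-! ### Cap-detection: transfer along maps, and duality with cup-generation -/

namespace Literature.AlgebraicTopology.SingularHomology

open CategoryTheory Set Literature.Algebra.Homology

variable (K : Type v) [Field K] {X : Type u} [TopologicalSpace X]

/-- **Cap-detection transfers along a map which is onto in degree `n` and into in the
complementary degrees.** If the classes `f^* g_j` jointly detect `H_n(X'; K)` under the cap product
(`∀ j, f^*g_j ⌢ x' = 0 ⇒ x' = 0`), `f_* : H_n(X') → H_n(X)` is onto and
`f_* : H_{e_j}(X') → H_{e_j}(X)` is into, then the `g_j` jointly detect `H_n(X; K)` (projection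
formula `f_*(f^*a ⌢ c) = a ⌢ f_*c`, Hatcher 2002, §3.3 p. 241). Used with homeomorphisms and weak
homotopy equivalences. [cite: HatcherAT2002, §3.3 p. 241] -/
theorem eq_zero_of_forall_capProduct_eq_zero_of_map {X' : Type u} [TopologicalSpace X']
    (f : C(X', X)) {J : Type*} {n : ℕ} {d e : J → ℕ} (hde : ∀ j, d j + e j = n)
    (g : ∀ j, singularCohomology K K X (d j))
    (hdet : ∀ x' : singularHomology K K X' n,
      (∀ j, capProduct (hde j) (singularCohomology.map K K f (d j) (g j)) x' = 0) → x' = 0)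
    (hsurj : Surjective (singularHomology.map K K f n).hom)
    (hinj : ∀ j, Injective (singularHomology.map K K f (e j)).hom)
    {x : singularHomology K K X n} (hx : ∀ j, capProduct (hde j) (g j) x = 0) : x = 0 := by
  obtain ⟨x', rfl⟩ := hsurj x
  have hx' : x' = 0 := hdet x' fun j => hinj j (by
    change singularHomology.map K K f (e j) _ = singularHomology.map K K f (e j) 0
    rw [map_zero, capProduct_map]
    exact hx j)
  rw [hx', map_zero]

/-- A continuous map with a two-sided continuous inverse induces bijections on homology.
[cite: HatcherAT2002, §2.1 (remark after Prop. 2.9)] -/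
theorem singularHomology.map_bijective_of_inverse {X' : Type u} [TopologicalSpace X']
    (f : C(X', X)) (g : C(X, X')) (hgf : g.comp f = ContinuousMap.id X')
    (hfg : f.comp g = ContinuousMap.id X) (q : ℕ) :
    Bijective (singularHomology.map K K f q).hom := by
  have h1 : (singularHomology.map K K g q).hom ∘ₗ (singularHomology.map K K f q).hom = LinearMap.id := by
    rw [← ModuleCat.hom_comp, ← singularHomology.map_comp, hgf, singularHomology.map_id]
    rfl
  have h2 : (singularHomology.map K K f q).hom ∘ₗ (singularHomology.map K K g q).hom = LinearMap.id := by
    rw [← ModuleCat.hom_comp, ← singularHomology.map_comp, hfg, singularHomology.map_id]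
    rfl
  exact ⟨LinearMap.injective_of_comp_eq_id _ _ h1, LinearMap.surjective_of_comp_eq_id _ _ h2⟩

/-- **Duality: joint cap-detection of `H_n` is cup-generation of `Hⁿ`.** Over a field `K`, with
`H_n(X; K)` finite-dimensional: if classes `g_j ∈ H^{d_j}(X; K)` jointly detect `H_n(X; K)` under
the cap product (`∀ j, g_j ⌢ x = 0 ⇒ x = 0`), then `Hⁿ(X; K) = Σ_j g_j ⌣ H^{e_j}(X; K)`
(`d_j + e_j = n`). Proof: under the Kronecker isomorphism `Hⁿ ≅ Hom(H_n, K)` (universal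
coefficients over a field, Hatcher Thm. 3.2 / p. 198) and the adjunction `⟨a ⌣ b, x⟩ = ⟨b, a ⌢ x⟩`
(Hatcher §3.3 p. 241) the co-annihilator of `Σ_j g_j ⌣ H^{e_j}` is `{x | ∀ j, g_j ⌢ x = 0} = 0`,
and a subspace of the dual of a finite-dimensional space with zero co-annihilator is everything.
[cite: HatcherAT2002, §3.1 Thm. 3.2 (p. 198) and §3.3 p. 241] -/
theorem iSup_range_cupProduct_eq_top_of_forall_capProduct_eq_zero {J : Type*} {n : ℕ}
    {d e : J → ℕ} (hde : ∀ j, d j + e j = n) (g : ∀ j, singularCohomology K K X (d j))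
    [FiniteDimensional K (singularHomology K K X n)]
    (hdet : ∀ x : singularHomology K K X n, (∀ j, capProduct (hde j) (g j) x = 0) → x = 0) :
    ⨆ j, LinearMap.range (cupProduct (hde j) (g j)) = (⊤ : Submodule K (singularCohomology K K X n)) := by
  set S : Submodule K (singularCohomology K K X n) := ⨆ j, LinearMap.range (cupProduct (hde j) (g j))
    with hS
  -- the Kronecker isomorphism `Hⁿ ≅ Hom(H_n, K)`
  set κ : singularCohomology K K X n ≃ₗ[K] Module.Dual K (singularHomology K K X n) :=
    LinearEquiv.ofBijective (kroneckerPairing K K X n) (kroneckerPairing_bijective_of_field K X n)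
    with hκ
  -- `κ(S)` has zero co-annihilator
  have hW : (S.map (κ : singularCohomology K K X n →ₗ[K]
      Module.Dual K (singularHomology K K X n))).dualCoannihilator = ⊥ := by
    rw [Submodule.eq_bot_iff]
    intro x hx
    rw [Submodule.mem_dualCoannihilator] at hx
    refine hdet x fun j => (Module.forall_dual_apply_eq_zero_iff K _).1 fun φ => ?_
    obtain ⟨u, rfl⟩ := (kroneckerPairing_bijective_of_field K X (e j)).2 φ
    rw [← kroneckerPairing_cupProduct]
    exact hx _ (Submodule.mem_map_of_mem
      (Submodule.mem_iSup_of_mem j (LinearMap.mem_range_self _ u)))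
  -- hence `κ(S)` is everything, and so is `S`
  have htop : S.map (κ : singularCohomology K K X n →ₗ[K]
      Module.Dual K (singularHomology K K X n)) = ⊤ := by
    rw [← Subspace.dualCoannihilator_dualAnnihilator_eq (W := S.map _), hW,
      Submodule.dualAnnihilator_bot]
  rw [← Submodule.comap_map_eq_of_injective κ.injective S, htop, Submodule.comap_top]

/-- Membership in a finite supremum of ranges: `x ∈ ⨆ j, range (T j)` iff `x = Σ_j T_j v_j`.
[folklore] -/
theorem mem_iSup_range_iff_exists_sum {J : Type*} [Fintype J] [DecidableEq J]
    {V : J → Type*} [∀ j, AddCommGroup (V j)] [∀ j, Module K (V j)]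
    {W : Type*} [AddCommGroup W] [Module K W] (T : ∀ j, V j →ₗ[K] W) (x : W) :
    x ∈ ⨆ j, LinearMap.range (T j) ↔ ∃ v : ∀ j, V j, x = ∑ j, T j (v j) := by
  constructor
  · intro hx
    induction hx using Submodule.iSup_induction' with
    | mem j x hx =>
      obtain ⟨u, rfl⟩ := hx
      refine ⟨Pi.single j u, ?_⟩
      rw [Finset.sum_eq_single j (fun k _ hkj => by rw [Pi.single_eq_of_ne hkj, map_zero])
        (fun h => absurd (Finset.mem_univ j) h), Pi.single_eq_same]
    | zero => exact ⟨0, by simp⟩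
    | add x y _ _ hx hy =>
      obtain ⟨v, rfl⟩ := hx
      obtain ⟨w, rfl⟩ := hy
      exact ⟨v + w, by simp [Finset.sum_add_distrib]⟩
  · rintro ⟨v, rfl⟩
    exact Submodule.sum_mem _ fun j _ => Submodule.mem_iSup_of_mem j (LinearMap.mem_range_self _ _)

/-- **Explicit form of the duality for finitely many classes**: every `c ∈ Hⁿ(X; K)` is
`Σ_j g_j ⌣ u_j`. [cite: HatcherAT2002, §3.1 Thm. 3.2 (p. 198) and §3.3 p. 241] -/
theorem exists_eq_sum_cupProduct_of_forall_capProduct_eq_zero {J : Type*} [Fintype J] {n : ℕ}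
    {d e : J → ℕ} (hde : ∀ j, d j + e j = n) (g : ∀ j, singularCohomology K K X (d j))
    [FiniteDimensional K (singularHomology K K X n)]
    (hdet : ∀ x : singularHomology K K X n, (∀ j, capProduct (hde j) (g j) x = 0) → x = 0)
    (c : singularCohomology K K X n) :
    ∃ u : ∀ j, singularCohomology K K X (e j), c = ∑ j, cupProduct (hde j) (g j) (u j) := by
  classical
  exact (mem_iSup_range_iff_exists_sum K (fun j => cupProduct (hde j) (g j)) c).1
    ((iSup_range_cupProduct_eq_top_of_forall_capProduct_eq_zero K hde g hdet).symm ▸ Submodule.mem_top)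

/-- **Cup-generation on a space from cap-detection on a space mapping to it** by a map onto in
degree `n` and into in the complementary degrees on homology (e.g. a weak homotopy equivalence
`P → E_a` from the pull-back of a bundle to a CW model of its base), `H_n` of the source being
finite-dimensional: every `c ∈ Hⁿ(X; K)` is `Σ_j g_j ⌣ u_j`.
[cite: HatcherAT2002, §3.1 Thm. 3.2 (p. 198) and §3.3 p. 241] -/
theorem exists_eq_sum_cupProduct_of_capDetect_of_map {X' : Type u} [TopologicalSpace X']
    (f : C(X', X)) {J : Type*} [Fintype J] {n : ℕ} {d e : J → ℕ} (hde : ∀ j, d j + e j = n)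
    (g : ∀ j, singularCohomology K K X (d j))
    [FiniteDimensional K (singularHomology K K X' n)]
    (hdet : ∀ x' : singularHomology K K X' n,
      (∀ j, capProduct (hde j) (singularCohomology.map K K f (d j) (g j)) x' = 0) → x' = 0)
    (hsurj : Surjective (singularHomology.map K K f n).hom)
    (hinj : ∀ j, Injective (singularHomology.map K K f (e j)).hom)
    (c : singularCohomology K K X n) :
    ∃ u : ∀ j, singularCohomology K K X (e j), c = ∑ j, cupProduct (hde j) (g j) (u j) := by
  haveI : FiniteDimensional K (singularHomology K K X n) := Module.Finite.of_surjective _ hsurj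
  exact exists_eq_sum_cupProduct_of_forall_capProduct_eq_zero K hde g
    (fun x hx => eq_zero_of_forall_capProduct_eq_zero_of_map K f hde g hdet hsurj hinj hx) c

/-- In degrees `2 + 2` the cup product is commutative (`(-1)^{2·2} = 1`, Hatcher Thm. 3.11), so
`η ⌣ H² = H² ⌣ η`: the generation statements below may be read with either order of the factors.
[cite: HatcherAT2002, Thm. 3.11] -/
theorem cupProduct_comm_two_two (a b : singularCohomology K K X 2) :
    cupProduct (show 2 + 2 = 4 by rfl) a b = cupProduct (show 2 + 2 = 4 by rfl) b a := by
  rw [cupProduct_gradedComm_holds K X (show 2 + 2 = 4 by rfl) (show 2 + 2 = 4 by rfl) a b]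
  norm_num

/-! ### The three-stage filtration: detection of `H₄` and generation of `H⁴` -/

namespace Filtration

variable (F : ℕ → Set X) (hF : Monotone F) (hcpt : ∀ C : Set X, IsCompact C → ∃ s, C ⊆ F s)
  (η : singularCohomology K K X 2) {ι : Type*} (ζ : ι → singularCohomology K K X 2)

/-- **Cap-detection of `H₄(X₂)` for a filtered space with hard Lefschetz on `E¹` (surface-bundle
window).** Let `X₀ ⊆ X₁ ⊆ X₂ ⊆ ⋯` be an increasing filtration (every compact set in some `X_s`),
`η ∈ H²(X; K)` a class whose cap product satisfies hard Lefschetz on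
`E¹ = ⊕_s H_•(X_s, X_{s-1}; K)` centred at fibre degree `2` (`Filtration.capEndo`,
`EHardLefschetz 2`), and `ζ_i ∈ H²(X; K)` classes whose relative cap products jointly detect
`H₄(X₂, X₁; K)`. Then a class `x ∈ H₄(X₂; K)` with `η ⌢ x = 0` and `ζ_i ⌢ x = 0` for all `i`
vanishes. For the skeletal filtration `X_s = p⁻¹(Cˢ)` of a bundle of compact Kähler surfaces over
a CW complex these hypotheses are fibrewise hard Lefschetz (`H₃(F) ≅ H₁(F)`, `H₄(F) ≅ H₀(F)` under
`η|_F ⌢`) and "the `ζ_i|_F` span `H²(F)`", through `E¹_{s,q} = ⊕_{s-cells} H_{q-s}(F)`; this is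
the homological form of the Künneth decomposition `H²(U, R²f_*ℚ) ≅ ⊕_i H²(U, ℚ) ∪ [𝒵_i]` and of
hard Lefschetz `R¹ ≅ R³` in the proof of Arapura 2022, Cor. 1.5 / Thm. 1.2.
[cite: Arapura2022, proof of Cor. 1.5 (p. 5) and proof of Thm. 1.2 (first reflection)]
[cite: VoisinHodgeII2003, Lemma 4.13 and Thm. 4.15 (proof)] -/
theorem eq_zero_of_capProduct_eq_zero_of_eHardLefschetz
    (hL : (capEndo K F hF η hcpt).EHardLefschetz 2)
    (hZ : ∀ e : relativeSingularHomology K K ↥(F 2) (Subtype.val ⁻¹' F 1) 4,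
      (∀ i, relCapProduct (Subtype.val ⁻¹' F 1) (show 2 + 2 = 4 by rfl)
        (restrictClass K F (ζ i) 2) e = 0) → e = 0)
    {x : singularHomology K K ↥(F 2) 4}
    (hη : capProduct (show 2 + 2 = 4 by rfl) (restrictClass K F η 2) x = 0)
    (hζ : ∀ i, capProduct (show 2 + 2 = 4 by rfl) (restrictClass K F (ζ i) 2) x = 0) : x = 0 :=
  (capEndo K F hF η hcpt).eq_zero_of_LA_eq_zero_of_eHardLefschetz
    (fun i => capEndo K F hF (ζ i) hcpt) hL hZ hη hζ

/-- **The same on `X` itself when `X₂ = X`** (transfer along the tautological homeomorphism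
`X₂ = ↥univ ≃ X`). [cite: Arapura2022, proof of Cor. 1.5 (p. 5)] [cite: HatcherAT2002, §3.3 p. 241] -/
theorem eq_zero_of_capProduct_eq_zero_of_eHardLefschetz_of_eq_univ (huniv : F 2 = univ)
    (hL : (capEndo K F hF η hcpt).EHardLefschetz 2)
    (hZ : ∀ e : relativeSingularHomology K K ↥(F 2) (Subtype.val ⁻¹' F 1) 4,
      (∀ i, relCapProduct (Subtype.val ⁻¹' F 1) (show 2 + 2 = 4 by rfl)
        (restrictClass K F (ζ i) 2) e = 0) → e = 0)
    {x : singularHomology K K X 4}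
    (hη : capProduct (show 2 + 2 = 4 by rfl) η x = 0)
    (hζ : ∀ i, capProduct (show 2 + 2 = 4 by rfl) (ζ i) x = 0) : x = 0 := by
  -- the inclusion `X₂ ⊆ X` is a homeomorphism
  set g : C(X, ↥(F 2)) := ⟨fun y => ⟨y, huniv ▸ mem_univ y⟩, by fun_prop⟩ with hg
  have hbij : ∀ q, Bijective (singularHomology.map K K (subsetIncl (F 2)) q).hom := fun q =>
    singularHomology.map_bijective_of_inverse K (subsetIncl (F 2)) g (by ext y; rfl) (by ext y; rfl) q
  refine eq_zero_of_forall_capProduct_eq_zero_of_map K (subsetIncl (F 2)) (J := Option ι)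
    (d := fun _ => 2) (e := fun _ => 2) (fun _ => (rfl : 2 + 2 = 4)) (fun j => j.elim η ζ)
    (fun x' hx' => ?_) (hbij 4).2 (fun _ => (hbij 2).1) fun j => ?_
  · exact eq_zero_of_capProduct_eq_zero_of_eHardLefschetz K F hF hcpt η ζ hL hZ (hx' none)
      fun i => hx' (some i)
  · cases j with
    | none => exact hη
    | some i => exact hζ i

/-- **`H⁴(X; K) = η ⌣ H²(X; K) + Σ_i ζ_i ⌣ H²(X; K)` for a space filtered in three stages with
hard Lefschetz on `E¹`** (the topological generation statement behind Arapura 2022, Cor. 1.5: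
"`H²(U, R²f_*ℚ) ≅ ⊕_i H²(U, ℚ) ∪ [𝒵_i]`" together with `H⁴ ↠ H¹(U, R³) = h ∪ H¹(U, R¹)` and
`H⁰(U, R⁴) = ℚ h²`, read off the Leray spectral sequence of the smooth family over the affine
surface `U`, degenerate by Deligne). Hypotheses: `X₂ = X`, `H₄(X; K)` finite-dimensional, the cap
product with `η` satisfies `EHardLefschetz 2` on the couple of the filtration, and the relative cap
products with the `ζ_i` jointly detect `H₄(X₂, X₁; K)`. By `cupProduct_comm_two_two` the factors
may be exchanged. [cite: Arapura2022, proof of Cor. 1.5 (p. 5) and proof of Thm. 1.2 (first reflection)]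
[cite: VoisinHodgeII2003, Lemma 4.13 and Thm. 4.15 (proof)] [cite: HatcherAT2002, §3.1 Thm. 3.2 and §3.3 p. 241] -/
theorem range_cupProduct_sup_iSup_eq_top_of_eHardLefschetz (huniv : F 2 = univ)
    [FiniteDimensional K (singularHomology K K X 4)]
    (hL : (capEndo K F hF η hcpt).EHardLefschetz 2)
    (hZ : ∀ e : relativeSingularHomology K K ↥(F 2) (Subtype.val ⁻¹' F 1) 4,
      (∀ i, relCapProduct (Subtype.val ⁻¹' F 1) (show 2 + 2 = 4 by rfl)
        (restrictClass K F (ζ i) 2) e = 0) → e = 0) :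
    LinearMap.range (cupProduct (show 2 + 2 = 4 by rfl) η) ⊔
        ⨆ i, LinearMap.range (cupProduct (show 2 + 2 = 4 by rfl) (ζ i)) =
      (⊤ : Submodule K (singularCohomology K K X 4)) := by
  have h := iSup_range_cupProduct_eq_top_of_forall_capProduct_eq_zero K (J := Option ι)
    (d := fun _ => 2) (e := fun _ => 2) (fun _ => (rfl : 2 + 2 = 4)) (fun j => j.elim η ζ)
    fun x hx => eq_zero_of_capProduct_eq_zero_of_eHardLefschetz_of_eq_univ K F hF hcpt η ζ huniv
      hL hZ (hx none) fun i => hx (some i)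
  rw [iSup_option] at h
  exact h

/-- **Explicit form: `c = η ⌣ w + Σ_i ζ_i ⌣ u_i` for every `c ∈ H⁴(X; K)`**, finitely many `ζ_i`.
[cite: Arapura2022, proof of Cor. 1.5 (p. 5) and proof of Thm. 1.2 (first reflection)]
[cite: HatcherAT2002, §3.1 Thm. 3.2 and §3.3 p. 241] -/
theorem exists_eq_cupProduct_add_sum_of_eHardLefschetz [Fintype ι] (huniv : F 2 = univ)
    [FiniteDimensional K (singularHomology K K X 4)]
    (hL : (capEndo K F hF η hcpt).EHardLefschetz 2)
    (hZ : ∀ e : relativeSingularHomology K K ↥(F 2) (Subtype.val ⁻¹' F 1) 4,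
      (∀ i, relCapProduct (Subtype.val ⁻¹' F 1) (show 2 + 2 = 4 by rfl)
        (restrictClass K F (ζ i) 2) e = 0) → e = 0)
    (c : singularCohomology K K X 4) :
    ∃ (w : singularCohomology K K X 2) (u : ι → singularCohomology K K X 2),
      c = cupProduct (show 2 + 2 = 4 by rfl) η w +
        ∑ i, cupProduct (show 2 + 2 = 4 by rfl) (ζ i) (u i) := by
  obtain ⟨u, hu⟩ := exists_eq_sum_cupProduct_of_forall_capProduct_eq_zero K (J := Option ι)
    (d := fun _ => 2) (e := fun _ => 2) (fun _ => (rfl : 2 + 2 = 4)) (fun j => j.elim η ζ)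
    (fun x hx => eq_zero_of_capProduct_eq_zero_of_eHardLefschetz_of_eq_univ K F hF hcpt η ζ huniv
      hL hZ (hx none) fun i => hx (some i)) c
  refine ⟨u none, fun i => u (some i), ?_⟩
  rw [hu, Fintype.sum_option]
  rfl

end Filtration

end Literature.AlgebraicTopology.SingularHomology
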